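import Summits.KontsevichZagierPeriods.KontsevichZagierPeriods.Theorems.SoloBlindEnneaCoverPrep
import HarnessLib

/-!
# The level-18 cover: the Kummer density and the pull-back identity

Continuation of `SoloBlindEnneaCoverPrep`.  With `E(W) = W^{-2/3}(1-W³)^{-5/6}` (the density
whose monomial multiples `3W^jE(W)dW` become the Beta forms `s^{a_j-1}(1-s)^{-5/6}ds`,
`a_j = (3j+1)/9`, after `s = W³` — `en_cube`) and `θ = b^{1/3} · S · E` we prove the
pull-back identity along the degree-four map `F` of the Prep file,

  `t^{-5/6}(1-t)^{-2/3}|_{t = F(W)} · |F'(W)| = θ(W)`   on `(0,1)`   (`en_pull`),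

by comparing sixth powers (`1 - F = W(W-p)³/Q²`, `|F'| = b²(W-p)²S/Q³`, so both sides to the
sixth are `b² S⁶ W⁻⁴ (1-W³)⁻⁵`), together with the integrability and
`ℚ`-semialgebraicity facts needed to run these forms through the Kontsevich–Zagier
substitution rule (`SoloBlindEnneaCover`).
-/

noncomputable section

open Set MeasureTheory MvPolynomial

namespace Summit.KontsevichZagierPeriods.KontsevichZagierPeriods.Theorems

namespace SoloBlind

open Literature.ModelTheory.ExponentialFields (IsSemialgebraic)
open Literature.NumberTheory.Transcendental
open Literature.NumberTheory.Transcendental.KZ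

/-! ## The Kummer density `E` and the words `3W^jE` -/

/-- `E(W) = W^{-2/3}(1-W³)^{-5/6}`. -/
def enE (W : ℝ) : ℝ := W ^ (-(2 / 3 : ℝ)) * (1 - W ^ 3) ^ (-(5 / 6 : ℝ))

/-- `E > 0` on `(0,1)`. -/
theorem enE_pos {W : ℝ} (hW : W ∈ Ioo (0:ℝ) 1) : 0 < enE W :=
  mul_pos (Real.rpow_pos_of_pos hW.1 _) (Real.rpow_pos_of_pos (one_sub_pow_three_pos hW) _)

/-- The exponents `a_j = (3j+1)/9`. -/
def enA (j : ℕ) : ℚ := (3 * j + 1) / 9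

/-- `0 < a_j`. -/
theorem enA_pos (j : ℕ) : 0 < enA j := by unfold enA; positivity

/-- `(W³)^{a_j-1} · 3W² = 3 W^j W^{-2/3}`. -/
theorem en_cube_rpow {W : ℝ} (hW : 0 < W) (j : ℕ) :
    (W ^ 3) ^ ((enA j : ℝ) - 1) * (3 * W ^ 2) = 3 * (W ^ j * W ^ (-(2 / 3 : ℝ))) := by
  have q1 : (W ^ 3 : ℝ) ^ ((enA j : ℝ) - 1) = W ^ (3 * ((enA j : ℝ) - 1)) := by
    rw [← Real.rpow_natCast W 3, ← Real.rpow_mul hW.le]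
    norm_num
  have q2 : (W ^ 2 : ℝ) = W ^ (2:ℝ) := by
    rw [← Real.rpow_natCast]
    norm_num
  have q3 : W ^ (3 * ((enA j : ℝ) - 1)) * W ^ (2:ℝ) = W ^ ((j:ℝ) + -(2 / 3 : ℝ)) := by
    rw [← Real.rpow_add hW]
    congr 1
    unfold enA
    push_cast
    ring
  rw [q1, q2, mul_left_comm, q3, Real.rpow_add hW, Real.rpow_natCast]

/-- **Pull-back along `s = W³`:** `3W^jE(W) = s^{a_j-1}(1-s)^{-5/6}|_{s=W³} · |3W²|` on
`(0,1)`. -/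
theorem en_cube {W : ℝ} (hW : W ∈ Ioo (0:ℝ) 1) (j : ℕ) :
    3 * (W ^ j * enE W) = betaFun (enA j) (1 / 6) (W ^ 3) * |3 * W ^ 2| := by
  have h0 := hW.1
  rw [betaFun, abs_of_pos (by positivity), enE,
    show (((1 / 6 : ℚ) : ℝ) - 1) = -(5 / 6 : ℝ) by norm_num, mul_right_comm,
    en_cube_rpow h0 j]
  ring

/-- `3W^jE(W)` is integrable on `(0,1)` (it is the transport of a Beta integrand). -/
theorem integrableOn_enR (j : ℕ) :
    IntegrableOn (fun W => 3 * (W ^ j * enE W)) (Ioo 0 1) := by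
  have h := integrableOn_betaFun (enA j) (1 / 6) (enA_pos j) (by norm_num)
  rw [image_pow_three, integrableOn_image_iff_integrableOn_abs_deriv_smul measurableSet_Ioo
    (fun v _ => hasDerivWithinAt_pow_three _ v) injOn_pow_three] at h
  exact h.congr_fun (fun v hv => by simp only [smul_eq_mul]; rw [mul_comm, ← en_cube hv j])
    measurableSet_Ioo

/-- `E` is `ℚ`-semialgebraic on `(0,1)`. -/
theorem sa_enE :
    IsSemialgebraicFunOn ℚ (line (Ioo (0:ℝ) 1)) (fun x : Fin 1 → ℝ => enE (x 0)) := by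
  have hX : IsSemialgebraicFunOn ℚ (line (Ioo (0:ℝ) 1)) (fun x : Fin 1 → ℝ => x 0) :=
    sa_coord mix_line_sa
  have hP :
      IsSemialgebraicFunOn ℚ (line (Ioo (0:ℝ) 1)) (fun x : Fin 1 → ℝ => 1 - x 0 ^ 3) :=
    (isSemialgebraicFunOn_aeval mix_line_sa (1 - X 0 ^ 3 : MvPolynomial (Fin 1) ℚ)).congr
      fun x _ => by simp
  have h1 := IsSemialgebraicFunOn.rpow_ratCast mix_line_sa hX (fun x hx => hx.1) (-(2 / 3))
  have h2 := IsSemialgebraicFunOn.rpow_ratCast mix_line_sa hP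
    (fun x hx => one_sub_pow_three_pos hx) (-(5 / 6))
  refine (IsSemialgebraicFunOn.mul_holds h1 h2).congr fun x _ => ?_
  simp only [enE, Pi.mul_apply]
  norm_num

/-- `p(W) E(W)` is `ℚ`-semialgebraic on `(0,1)` for a polynomial `p` over `ℚ`. -/
theorem sa_poly_enE (p : MvPolynomial (Fin 1) ℚ) :
    IsSemialgebraicFunOn ℚ (line (Ioo (0:ℝ) 1))
      (fun x : Fin 1 → ℝ => aeval x p * enE (x 0)) :=
  (IsSemialgebraicFunOn.mul_holds (isSemialgebraicFunOn_aeval mix_line_sa p) sa_enE).congr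
    fun x _ => by simp only [Pi.mul_apply]

/-- `3 x₀^j E(x₀)` is `ℚ`-semialgebraic on `(0,1)`. -/
theorem sa_enR (j : ℕ) : IsSemialgebraicFunOn ℚ (line (Ioo (0:ℝ) 1))
    (fun x : Fin 1 → ℝ => 3 * (x 0 ^ j * enE (x 0))) :=
  (sa_poly_enE (3 * X 0 ^ j)).congr fun x _ => by
    simp only [map_mul, map_pow, map_ofNat, aeval_X]; ring

/-- `a · p(W) E(W)` is `ℚ`-semialgebraic on `(0,1)` (`a` algebraic, `p` a polynomial over `ℚ`).
-/
theorem sa_const_poly_enE {a : ℝ} (ha : IsAlgebraic ℚ a) (p : MvPolynomial (Fin 1) ℚ) :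
    IsSemialgebraicFunOn ℚ (line (Ioo (0:ℝ) 1))
      (fun x : Fin 1 → ℝ => a * (aeval x p * enE (x 0))) :=
  (IsSemialgebraicFunOn.mul_holds (isSemialgebraicFunOn_const_of_isAlgebraic mix_line_sa ha)
    (sa_poly_enE p)).congr fun x _ => by simp only [Pi.mul_apply]

/-! ## The constant `λ = b^{1/3}` and the form `θ = λ S E` -/

/-- `λ = b^{1/3}`, the sixth root of `b²`. -/
def enL : ℝ := bN ^ (1 / 3 : ℝ)

/-- `0 < λ`. -/
theorem enL_pos : 0 < enL := Real.rpow_pos_of_pos bN_pos _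

/-- `λ⁶ = b²`. -/
theorem enL_pow_six : enL ^ 6 = bN ^ 2 := by
  rw [enL, rpow_pow_six bN_pos (k := 2) (by norm_num)]
  norm_cast

/-- `λ` is algebraic. -/
theorem isAlgebraic_enL : IsAlgebraic ℚ enL := by
  have h := Literature.NumberTheory.Transcendental.isAlgebraic_rpow_ratCast isAlgebraic_bN
    bN_pos (1 / 3)
  push_cast at h
  exact h

/-- `θ(W) = λ · S(W) · E(W)`, the pull-back of the `B(1/6,1/3)`-integrand along `F`. -/
def enTheta (W : ℝ) : ℝ := enL * (enS W * enE W)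

/-- `θ > 0` on `(0,1)`. -/
theorem enTheta_pos {W : ℝ} (hW : W ∈ Ioo (0:ℝ) 1) : 0 < enTheta W :=
  mul_pos enL_pos (mul_pos (enS_pos hW.1.le hW.2.le) (enE_pos hW))

/-- `θ⁶ = b² S⁶ W⁻⁴ (1-W³)⁻⁵`. -/
theorem enTheta_pow_six {W : ℝ} (hW : W ∈ Ioo (0:ℝ) 1) :
    enTheta W ^ 6 = bN ^ 2 * (enS W ^ 6 * (W ^ (-4:ℤ) * (1 - W ^ 3) ^ (-5:ℤ))) := by
  unfold enTheta enE
  rw [mul_pow, mul_pow, mul_pow, enL_pow_six, rpow_pow_six hW.1 (k := -4) (by norm_num),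
    rpow_pow_six (one_sub_pow_three_pos hW) (k := -5) (by norm_num)]

/-! ## The pull-back identity -/

/-- **Pull-back along `F`:** `t^{-5/6}(1-t)^{-2/3}|_{t=F} |F'| = θ` on `(0,1)`. -/
theorem en_pull {W : ℝ} (hW : W ∈ Ioo (0:ℝ) 1) :
    enTheta W = betaFun (1 / 6) (1 / 3) (enF W) * |enF' W| := by
  have h0 := hW.1.le
  have h1 := hW.2.le
  have hW0 := hW.1
  have hQ := enQ_pos h0
  have hS := enS_pos h0 h1
  have hp : 0 < W - enP := by linarith [hW.1, enP_neg]
  have hb := bN_pos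
  have hQ' := hQ.ne'
  have hS' := hS.ne'
  have hp' := hp.ne'
  have hb' := hb.ne'
  have hW3 := (one_sub_pow_three_pos hW).ne'
  have hF : 0 < enF W := (enF_mem hW).1
  have hX : 0 < W * (W - enP) ^ 3 / enQ W ^ 2 := by positivity
  have hY : 0 < bN ^ 2 * ((W - enP) ^ 2 * enS W) / enQ W ^ 3 := by positivity
  rw [betaFun, one_sub_enF h0, abs_enF' h0 h1]
  refine (pow_left_inj₀ (enTheta_pos hW).le
    (mul_pos (mul_pos (Real.rpow_pos_of_pos hF _) (Real.rpow_pos_of_pos hX _)) hY).le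
    (by norm_num : (6:ℕ) ≠ 0)).mp ?_
  rw [enTheta_pow_six hW, mul_pow, mul_pow,
    rpow_pow_six hF (k := -5) (by push_cast; norm_num),
    rpow_pow_six hX (k := -4) (by push_cast; norm_num)]
  simp only [enF, zpow_neg, zpow_ofNat]
  field_simp

/-! ## Integrability -/

/-- `θ` is integrable on `(0,1)`: it is a combination of the transports `3W^jE(W)`. -/
theorem integrableOn_enTheta : IntegrableOn enTheta (Ioo 0 1) := by
  have h : IntegrableOn (fun v => enL * (-enV / 3 * (3 * (v ^ 0 * enE v)) -
      enU / 3 * (3 * (v ^ 1 * enE v)) - 1 / 3 * (3 * (v ^ 2 * enE v)))) (Ioo 0 1) :=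
    ((((integrableOn_enR 0).const_mul _).sub ((integrableOn_enR 1).const_mul _)).sub
      ((integrableOn_enR 2).const_mul _)).const_mul enL
  exact h.congr_fun (fun v _ => by simp only [enTheta, enS]; ring) measurableSet_Ioo

/-! ## Semialgebraicity -/

/-- `S` is `ℚ`-semialgebraic on any `ℚ`-semialgebraic line. -/
theorem sa_enS {S : Set ℝ} (hS : IsSemialgebraic ℚ (line S)) :
    IsSemialgebraicFunOn ℚ (line S) (fun x : Fin 1 → ℝ => enS (x 0)) := by
  have hX := sa_coord hS
  have h0 := isSemialgebraicFunOn_const_of_isAlgebraic hS isAlgebraic_enV.neg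
  have h1 := IsSemialgebraicFunOn.mul_holds
    (isSemialgebraicFunOn_const_of_isAlgebraic hS isAlgebraic_enU) hX
  have h2 := IsSemialgebraicFunOn.mul_holds hX hX
  exact (IsSemialgebraicFunOn.sub_holds (IsSemialgebraicFunOn.sub_holds h0 h1) h2).congr
    fun x _ => by simp only [enS, Pi.sub_apply, Pi.mul_apply]; ring

/-- `θ` is `ℚ`-semialgebraic on `(0,1)`. -/
theorem sa_enTheta_unit :
    IsSemialgebraicFunOn ℚ (line (Ioo (0:ℝ) 1)) (fun x => enTheta (x 0)) :=
  (IsSemialgebraicFunOn.mul_holds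
    (isSemialgebraicFunOn_const_of_isAlgebraic mix_line_sa isAlgebraic_enL)
    (IsSemialgebraicFunOn.mul_holds (sa_enS mix_line_sa) sa_enE)).congr
    fun x _ => by simp only [enTheta, Pi.mul_apply]

end SoloBlind

end Summit.KontsevichZagierPeriods.KontsevichZagierPeriods.Theorems
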